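import Summits.CriticalPhenomena.PercolationContinuityZ3.Theorems.Transplant.PlanarCellsPSep2
import HarnessLib

/-!
# Planar cells: NO-EDGE SEPARATION OF THE CUBE `Q_v` from the cells of the other macro-vertices and from all stub zones
# (the planar facts behind "no revealed vertex is adjacent to the corridor chain's habitat `Q_y ∪ H_{y,du}`", design (D), §11 v2)

builds on p205010 (kernel theorem, internal audit signed; external expert review pending) — nothing in this file uses p205010.
Lane `prim-bschramm`, seat `prim-bschramm-p3` (order I2 of V56: the entrance analysis of the corridor chain); helper file
(`--supports stmt-CriticalPhenomena-4575 --as helper`).  Continues `PlanarCellsPSep2` (`Cell_sep_Efar`, `Zone_sep_Efar`, `Btw_sep_Efar`).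

* `Cell_sep_Q` — `u ≠ v ⇒ Sep (Cell u) (Q v)` (cells `cen u ± 10r`, cubes `cen v ± 5r`, centres `20r` apart: gap `≥ 5r`);
* `Zone_sep_Q` — `Sep (Zone u δ) (Q v)` for ALL `u, δ, v` (the zone ends `10s` rows short of the next cube, and is `≥ 5r` from every other cube).
[cite: KozmaNitzan2024, §4 pp. 26, 31 — the ℤ^d model]
-/

noncomputable section

namespace Summit.CriticalPhenomena.PercolationContinuityZ3.Theorems

namespace Transplant

open Literature.Probability.Percolation Literature.Probability.LatticeModels SimpleGraph GadgetSystem Contour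
open Literature.Probability.Percolation.KozmaNitzan
open Literature.Probability.Percolation.KozmaNitzan.Cells (oth oth_ne sgOf sgOf_sign stepVec_apply_fst stepVec_apply_oth eq_oth_of_ne oth_oth
  eq_of_coords)

namespace PCells

variable (C : PCells)

/-- **Cells of other macro-vertices are separated from the cube `Q_v`** (`u ≠ v`): no common vertex, no edge. [cite: KozmaNitzan2024, §4 p. 26] -/
theorem Cell_sep_Q {u v : Site 2} (huv : u ≠ v) : KozmaNitzan.Sep (↑(C.Cell u) : Set (Site 2)) ↑(C.Q v) := by
  intro y hy z hz
  rw [Finset.mem_coe, Cell, C.mem_sq_iff] at hy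
  rw [Finset.mem_coe, Q, C.mem_sq_iff] at hz
  have hr : (1 : ℤ) ≤ C.r := by exact_mod_cast C.one_le_r
  -- `u` and `v` differ in some macro-coordinate
  have hne : ∃ i : Fin 2, u i ≠ v i := by
    by_contra h
    push Not at h
    exact huv (funext h)
  obtain ⟨i, hi⟩ := hne
  have hyi := hy i; have hzi := hz i
  push_cast at hyi hzi
  rcases C.cen_cases u v i with ⟨hk, hc⟩ | ⟨hk, hc⟩ | ⟨hk, hc⟩ | ⟨hk, hc⟩ | ⟨hk, hc⟩
  · exact sep_of_gap i (by omega)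
  · exact sep_of_gap i (by omega)
  · exact absurd hk hi
  · exact sep_of_gap i (by omega)
  · exact sep_of_gap i (by omega)

/-- **Stub zones are separated from every cube** `Q_v` (all `u, δ, v`): along the zone's axis the zone occupies the levels `[10r, 15r - 10s]`
from `cen u`, while a cube occupies `cen v ± 5r` with `cen v - cen u ∈ 20r·ℤ`. [cite: KozmaNitzan2024, §4 p. 26] -/
theorem Zone_sep_Q (u : Site 2) (δ : MDir) (v : Site 2) : KozmaNitzan.Sep (↑(C.Zone u δ) : Set (Site 2)) ↑(C.Q v) := by
  intro y hy z hz
  rw [Finset.mem_coe, Zone, mem_psBox_iff] at hy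
  rw [Finset.mem_coe, Q, C.mem_sq_iff] at hz
  obtain ⟨⟨hy1, hy2⟩, -, -⟩ := hy
  have hr : (1 : ℤ) ≤ C.r := by exact_mod_cast C.one_le_r
  have hs1 : (1 : ℤ) ≤ C.s := by exact_mod_cast C.hs
  have hs20 : 20 * (C.s : ℤ) ≤ C.r := by exact_mod_cast C.twenty_mul_s_le_r
  have hza := hz δ.1
  push_cast at hza
  rcases C.cen_cases u v δ.1 with ⟨hk, hc⟩ | ⟨hk, hc⟩ | ⟨hk, hc⟩ | ⟨hk, hc⟩ | ⟨hk, hc⟩ <;>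
    rcases sgOf_sign δ with hs | hs <;> rw [hs] at hy1 hy2 <;> exact sep_of_gap δ.1 (by omega)

end PCells

end Transplant

end Summit.CriticalPhenomena.PercolationContinuityZ3.Theorems

end
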